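import Summits.QuantumFields.YangMills.Theorems.AlphaInputsT3ACv3AbelianSmall
import Literature.MathematicalPhysics.QuantumFieldTheory.Balaban1983to89.TorusGeometry
import HarnessLib

/-!
# `AlphaInputsT3ACv3AbelianLocal` — STRATEGY B for 2′, toward (D6R-CHARGED): LOCAL PROPAGATION OF CURL BOUNDS THROUGH THE ITERATED (0.4) LINEAR AVERAGES — the curl of `linAvgIter s a`
# at a level-`s` plaquette `(y; μ, ν)` is at most `(L²)^s·B` as soon as the `(μ,ν)`-curls of `a` are `≤ B` on the fine sites lying under the nine level-`s` blocks `y + αe_μ + βe_ν`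
# (`α, β ≤ 2`) — lane `pub-balaban3d`, seat alpha-2 (g3)

WHAT (HOME `D6L-STATUS-alpha2-g3.md` §6 (c′); over `…AbelianStokes`/`…AbelianSmall`).  §1 torus block arithmetic in the standing range `j+1 ≤ m+K`: a shift by `a < L` fine steps changes the
block by at most one coarse step (`blockOf_shiftN_eq_or`), the offset points are the block's sites (`offPt_off_eq_blockSite`, `blockOf_offPt`); §2 the iterated block map `blockOfIter` and
★★ `abs_curlAt_linAvgIter_le_local` (induction on `s` with the nine-block footprint, which is stable: `N₁ + N₁ ⊆ N₂` and shifts by `≤ 2 < L` move blocks by `≤ 1`).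
HONEST FRAMING.  Kernel torus arithmetic; nothing of [B10]∕[7]∕[4]'s estimates asserted; count-neutral helper toward R3 2′ (`stub_laneRecordsV3`, items 19935∕19936); nothing about d = 4,
the continuum, or a mass gap.

References: T. Bałaban, Commun. Math. Phys. 109 (1987) 249–301 [Balaban1987RG1] ((0.1)–(0.4) pp.251–253).
-/

set_option autoImplicit false

noncomputable section

namespace Summit.QuantumFields.YangMills.Theorems.AbelianEML

open scoped BigOperators
open Literature.MathematicalPhysics.QuantumFieldTheory.Balaban1983to89
open Literature.MathematicalPhysics.QuantumFieldTheory.Balaban1983to89.T4Continuum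
open Literature.MathematicalPhysics.QuantumFieldTheory.Balaban1983to89.BlockAveraging (off Idx)
open Literature.MathematicalPhysics.QuantumFieldTheory.Balaban1983to89.BlockAveragingEMLProp2 (shiftN_apply walkEnd_stairWord_apply shift_shift_comm)
open Literature.MathematicalPhysics.QuantumFieldTheory.Balaban1983to89.B10Eq47AxialChi (shiftN shiftN_zero shiftN_succ)

variable {P : Params} {j : ℕ}

/-! ## §1 Torus block arithmetic (standing range) -/

/-- **A shift by `a < L` fine steps moves the block by at most one coarse step** (standing range `j+1 ≤ m+K`). [cite: Balaban1987RG1, (0.1) p.252 (bookkeeping)] -/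
theorem blockOf_shiftN_eq_or (hj : j + 1 ≤ P.m + P.K) (x : Site P j) (μ : Fin P.d) {a : ℕ} (ha : a < P.L) :
    blockOf (shiftN x μ a) = blockOf x ∨ blockOf (shiftN x μ a) = (blockOf x).shift μ := by
  have hL := P.L_pos
  have hn := P.sitesPerDir_eq_mul_succ hj
  have hN1 : 1 < P.sitesPerDir (j + 1) := P.one_lt_sitesPerDir (j + 1)
  haveI : NeZero (P.sitesPerDir j) := ⟨by rw [hn]; positivity⟩
  have hvlt : (x μ).val < P.sitesPerDir j := ZMod.val_lt _
  have hLn : P.L ≤ P.sitesPerDir j := by rw [hn]; exact Nat.le_mul_of_pos_left _ (by omega)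
  -- the shifted coordinates
  have hcoord : ∀ κ, shiftN x μ a κ = x κ + (if κ = μ then ((a : ℕ) : ZMod (P.sitesPerDir j)) else 0) := shiftN_apply x μ a
  have hval_a : ((a : ℕ) : ZMod (P.sitesPerDir j)).val = a := by
    rw [ZMod.val_natCast, Nat.mod_eq_of_lt]; exact ha.trans_le hLn
  -- other coordinates are unchanged
  have hother : ∀ κ, κ ≠ μ → blockOf (shiftN x μ a) κ = blockOf x κ := by
    intro κ hκ; simp only [blockOf, hcoord κ, if_neg hκ, add_zero]
  -- the `μ`-coordinate of the block moves by `0` or `1`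
  have key : blockOf (shiftN x μ a) μ = blockOf x μ ∨ blockOf (shiftN x μ a) μ = blockOf x μ + 1 := by
    simp only [blockOf]
    by_cases hwrap : (x μ).val + a < P.sitesPerDir j
    · -- no wrap-around: label `v + a`, block label `(v + a)/L ∈ {v/L, v/L + 1}`
      have hval : (shiftN x μ a μ).val = (x μ).val + a := by
        rw [hcoord μ, if_pos rfl, ZMod.val_add, hval_a, Nat.mod_eq_of_lt hwrap]
      have hq : ((x μ).val + a) / P.L = (x μ).val / P.L ∨ ((x μ).val + a) / P.L = (x μ).val / P.L + 1 := by
        have h1 : (x μ).val / P.L ≤ ((x μ).val + a) / P.L := Nat.div_le_div_right (Nat.le_add_right _ _)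
        have h2 : ((x μ).val + a) / P.L ≤ (x μ).val / P.L + 1 := by
          have : ((x μ).val + a) / P.L ≤ ((x μ).val + P.L) / P.L := Nat.div_le_div_right (by omega)
          rw [Nat.add_div_right _ hL] at this; exact this
        omega
      rw [hval]
      rcases hq with hq | hq
      · left; rw [hq]
      · right; rw [hq]; push_cast; ring
    · -- wrap-around: label `v + a − n_j < L`, block label `0`; and `v/L = n_{j+1} − 1`
      have hwrap' : P.sitesPerDir j ≤ (x μ).val + a := not_lt.mp hwrap
      right
      have hval : (shiftN x μ a μ).val = (x μ).val + a - P.sitesPerDir j := by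
        rw [hcoord μ, if_pos rfl, ZMod.val_add, hval_a, Nat.mod_eq_sub_mod hwrap', Nat.mod_eq_of_lt]
        omega
      have hsmall : ((x μ).val + a - P.sitesPerDir j) / P.L = 0 := Nat.div_eq_of_lt (by omega)
      have hq : (x μ).val / P.L = P.sitesPerDir (j + 1) - 1 := by
        have h1 : (x μ).val / P.L < P.sitesPerDir (j + 1) := by
          rw [Nat.div_lt_iff_lt_mul hL, ← hn]; exact hvlt
        have h2 : P.sitesPerDir (j + 1) - 1 ≤ (x μ).val / P.L := by
          rw [Nat.le_div_iff_mul_le hL]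
          have : (P.sitesPerDir (j + 1) - 1) * P.L = P.sitesPerDir j - P.L := by rw [hn, Nat.sub_mul, one_mul]
          omega
        omega
      rw [hval, hsmall, hq, Nat.cast_sub (by omega : 1 ≤ P.sitesPerDir (j + 1)), ZMod.natCast_self, Nat.cast_zero, Nat.cast_one]
      ring
  rcases key with h | h
  · left; funext κ
    by_cases hκ : κ = μ
    · subst hκ; exact h
    · exact hother κ hκ
  · right; funext κ
    by_cases hκ : κ = μ
    · subst hκ; rw [Site.shift_apply, if_pos rfl]; exact h
    · rw [hother κ hκ, Site.shift_apply, if_neg hκ]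

/-- **The offset points are the block's sites**: `offPt y (off r) = blockSite y r`. [cite: Balaban1987RG1, (0.3) p.252 (bookkeeping)] -/
theorem offPt_off_eq_blockSite (y : Site P (j + 1)) (r : Fin P.d → Fin P.L) : offPt y (off r) = Site.blockSite y r := by
  funext κ
  rw [offPt, walkEnd_stairWord_apply]
  simp only [emb, Site.blockSite, off, Int.cast_sub, Int.cast_natCast, Nat.cast_add, Nat.cast_mul]
  ring

/-- Hence the offset points lie in the block: `blockOf (offPt y (off r)) = y` (standing range). [cite: Balaban1987RG1, (0.3) p.252 (bookkeeping)] -/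
theorem blockOf_offPt (hj : j + 1 ≤ P.m + P.K) (y : Site P (j + 1)) (r : Fin P.d → Fin P.L) : blockOf (offPt y (off r)) = y := by
  rw [offPt_off_eq_blockSite, Site.blockOf_blockSite hj]

/-! ## §2 The nine-block footprint and the local iterated bound -/

/-- `3 ≤ L` (odd and `> 1`). [folklore] -/
theorem three_le_L : 3 ≤ P.L := by
  have h1 := P.hL.2; obtain ⟨k, hk⟩ := P.hL.1; omega

/-- **FOOTPRINT STABILITY**: if `blockOf z ∈ {y, y+e_μ, y+e_ν, y+e_ν+e_μ}` and `w = z + αe_μ + βe_ν` with `α, β ≤ 2`, then `blockOf w ∈ N₂(y; μ, ν)` (standing range; `2 < L`). [folklore] -/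
theorem blockOf_mem_nbhd2 (hj : j + 1 ≤ P.m + P.K) (y : Site P (j + 1)) (μ ν : Fin P.d) (z : Site P j) {a b : ℕ} (ha : a ≤ 1) (hb : b ≤ 1)
    (hz : blockOf z = shiftN (shiftN y μ a) ν b) {α β : ℕ} (hα : α ≤ 2) (hβ : β ≤ 2) :
    ∃ α' β' : ℕ, α' ≤ 2 ∧ β' ≤ 2 ∧ blockOf (shiftN (shiftN z μ α) ν β) = shiftN (shiftN y μ α') ν β' := by
  have hL := three_le_L (P := P)
  -- first the `μ`-shift, then the `ν`-shift; each moves the block by `0` or `1`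
  rcases blockOf_shiftN_eq_or hj z μ (a := α) (by omega) with h1 | h1 <;>
    rcases blockOf_shiftN_eq_or hj (shiftN z μ α) ν (a := β) (by omega) with h2 | h2
  · exact ⟨a, b, by omega, by omega, by rw [h2, h1, hz]⟩
  · exact ⟨a, b + 1, by omega, by omega, by rw [h2, h1, hz, shiftN_succ]⟩
  · refine ⟨a + 1, b, by omega, by omega, ?_⟩
    rw [h2, h1, hz, shiftN_succ, shift_shiftN_comm]
  · refine ⟨a + 1, b + 1, by omega, by omega, ?_⟩
    rw [h2, h1, hz, shiftN_succ, shiftN_succ, shift_shiftN_comm]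

/-- **THE ITERATED BLOCK MAP** `T^{(0)} → T^{(s)}`. [cite: Balaban1987RG1, (0.1) p.252] -/
def blockOfIter : (s : ℕ) → Site P 0 → Site P s
  | 0 => id
  | s + 1 => fun x => blockOf (blockOfIter s x)

/-- **★★ LOCAL PROPAGATION OF CURL BOUNDS**: if the `(μ,ν)`-curls of `a` are `≤ B` at every finest site whose level-`s` block ancestor lies in the nine-block neighbourhood `N₂(y; μ, ν) = {y + αe_μ + βe_ν : α, β ≤ 2}`, then
`|curl (linAvgIter s a)(y; μ, ν)| ≤ (L²)^s·B` (standing range `s ≤ m + K`). [cite: Balaban1987RG1, (0.4) p.253; Balaban1985Averaging, (14) p.19] -/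
theorem abs_curlAt_linAvgIter_le_local (a : PBond P 0 → ℝ) (μ ν : Fin P.d) {B : ℝ} :
    ∀ (s : ℕ), s ≤ P.m + P.K → ∀ (y : Site P s),
      (∀ x : Site P 0, (∃ α β : ℕ, α ≤ 2 ∧ β ≤ 2 ∧ blockOfIter s x = shiftN (shiftN y μ α) ν β) → |curlAt a x μ ν| ≤ B) →
        |curlAt (linAvgIter s a) y μ ν| ≤ ((P.L : ℝ) ^ 2) ^ s * B
  | 0, _, y, h => by simpa [linAvgIter] using h y ⟨0, 0, by omega, by omega, by simp [blockOfIter]⟩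
  | s + 1, hs, y, h => by
    rw [linAvgIter_succ, pow_succ, mul_comm (((P.L : ℝ) ^ 2) ^ s), mul_assoc]
    refine abs_curl_linAvg04_le (linAvgIter s a) y μ ν fun r σ t hσ ht => ?_
    -- the level-`s` position `z = offPt y n_r + t e_ν + σ e_μ` has `blockOf z ∈ {y, y+e_μ, y+e_ν, y+e_ν+e_μ}`
    set z := shiftN (shiftN (offPt y (off r)) ν t) μ σ with hz
    have hjs : s + 1 ≤ P.m + P.K := hs
    obtain ⟨a', b', ha', hb', hzb⟩ : ∃ a' b' : ℕ, a' ≤ 1 ∧ b' ≤ 1 ∧ blockOf z = shiftN (shiftN y μ a') ν b' := by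
      have h0 : blockOf (offPt y (off r)) = y := blockOf_offPt hjs y r
      rcases blockOf_shiftN_eq_or hjs (offPt y (off r)) ν ht with h1 | h1 <;>
        rcases blockOf_shiftN_eq_or hjs (shiftN (offPt y (off r)) ν t) μ hσ with h2 | h2
      · exact ⟨0, 0, by omega, by omega, by rw [hz, h2, h1, h0]; rfl⟩
      · exact ⟨1, 0, by omega, by omega, by rw [hz, h2, h1, h0]; rfl⟩
      · exact ⟨0, 1, by omega, by omega, by rw [hz, h2, h1, h0]; rfl⟩
      · exact ⟨1, 1, by omega, by omega, by rw [hz, h2, h1, h0, shiftN_succ, shiftN_zero, shiftN_succ, shiftN_zero, shift_shift_comm y ν μ]⟩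
    refine abs_curlAt_linAvgIter_le_local a μ ν s (by omega) z fun x hx => h x ?_
    -- footprint stability: `blockOfIter (s+1) x = blockOf (blockOfIter s x)` with `blockOfIter s x ∈ N₂(z)`
    obtain ⟨α, β, hα, hβ, hxz⟩ := hx
    show ∃ α' β' : ℕ, α' ≤ 2 ∧ β' ≤ 2 ∧ blockOf (blockOfIter s x) = shiftN (shiftN y μ α') ν β'
    rw [hxz]
    exact blockOf_mem_nbhd2 hjs y μ ν z ha' hb' hzb hα hβ

end Summit.QuantumFields.YangMills.Theorems.AbelianEML

end
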